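import Summits.BirchSwinnertonDyer.Rank1Residual.JET.CarrierReadingRecordsKit
import Summits.BirchSwinnertonDyer.Rank1Residual.GaloisImage.ThreeAdicFrobeniusWitness
import Summits.BirchSwinnertonDyer.Rank1Residual.X11b.CertificateCheckBridge
import HarnessLib

/-!
# T1 JET (cell `bsd-jet`), road «R-IDX» at `p = 3` with ANY reduction at `3`: the record kit's bucket-A
# front ends whose `3`-adic tower comes from ONE Frobenius witness modulo `9` (twin of pv-1's KitThree)

HONEST FRAMING (programme `BSD-LIT2PART-PROGRAMME-v1.md` §HONESTY, verbatim): «no tranche here proves BSD;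
ARM L moves the LITERAL column of an r ≤ 1 census into the kernel-proved-modulo-named-print column; ARM P
changes what «named print» is worth. The residue (4.31 %) and every SUMMIT-BEARING rung (S0–S3) stay
theorem-bound and are staffed by the 22 routes, not by this programme.» THEOREMS ONLY; PER PAIR; nothing is
booked by this file; what a record through this kit is worth is the referees' word on the READING binder
`hJ : JET.JetchevDivisibilityCarrierNe` (seat `bsd-jet-pv-1`, p459625, audit sheet
`HOME/sheets/PV1-A-BLOCK-READING.md`) and on a two-engine index line (`HOME/JET-PLAN.md`, decision point
«ROAD R-IDX»). Seat `bsd-jet-ty` (typer); generator `HOME/staging/bsd-jet-ty/tools/gen_jet_ridx_records.py`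
(kinds `A3F` / `A3FX`).

WHAT THIS FILE ADDS to `JET/CarrierReadingRecordsKit.lean` (p468192; §2 there needs `3` MULTIPLICATIVE for
the tower by the Tate line): the bucket-A rows at `p = 3` with `E` ADDITIVE at `3` (`9 ∣ N`; 61 173 of the
A pairs at `p = 3` in `HOME/jet_rows.tsv`) — and in fact ANY reduction at `3` —, where the `3`-adic tower
`ρ̄_{E,3^n}` onto for all `n` is read off the literal model by prover pv-1 g2's route (seat file
`Theorems/Rank1ResidualJetCarrierNeKitThree.lean`, class-free consumer
`JET.bsdp_of_carrierNeCertificate_level_three_of_frobenius`): `ρ̄_{E,3}` onto (two Frobenius witnesses,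
prover B's `Supersingular.surj_three_of_ainvs_of_irr_of_order`) plus ONE good prime `ℓ ≡ 2, 5 (mod 9)`
with `a_ℓ ≡ 3, 6 (mod 9)` (`GaloisImage.forall_hasSurjectiveModNGaloisRep_three_pow_of_intModel_of_frobenius`,
Serre IV-23 / Elkies 2006); then pv-1's general consumer `JET.bsdp_of_carrierNeCertificate_level` at that
tower. As in the parent kit the Tamagawa half is IN THE KERNEL (`TamLocal` singleton at a split `I_{3k}`
carrier — `bsdp_of_jetRowA3F_tam_min` —, or an exact `TamX` certificate at a `IV`/`IV*` carrier —
`bsdp_of_jetRowA3F_tamX_min`), so the DISPLAYED certificate is the pure index line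
`hv : ord₃ [E(K):ℤP] ≤ w`. Bucket B at an ADDITIVE `3` (carrier `3` of type `IV`/`IV*`, 19 341 pairs) has
NO reading binder (K3 is stated at a multiplicative carrier) and stays road C3's. Curves whose `3`-adic
image is onto mod `3` but not mod `9` (Elkies' `9`-adic exceptional images) have no such witness and are
listed, never emitted, by the generator. Nothing about any particular curve is asserted. PARTITION: row D5
`JET@p∣N` — 0 classes moved by this file.

References: D. Jetchev, Compos. Math. 144 (2008) Cor. 1.5 (p. 812) [Jetchev2008]; J.-P. Serre, *Abelian
ℓ-adic representations* (1968) IV-23 Lemma 3 [SerreAbelianLadic1968]; N. Elkies, arXiv:math/0612734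
(2006) Introduction [Elkies2006]; J.-P. Serre, Invent. Math. 15 (1972) §2.4 Prop. 15 [Serre1972];
J. H. Silverman, *ATAEC* (1994) IV.9.4 [SilvermanATAEC1994]; R. L. Miller (2011) Def. 1.1 [Miller2011LMS].
-/

set_option autoImplicit false

noncomputable section

open scoped Classical

open WeierstrassCurve Literature.NumberTheory.EllipticCurves
  Literature.NumberTheory.EllipticCurves.ModularForms
  Literature.NumberTheory.EllipticCurves.Rank1Residual
  Literature.NumberTheory.EllipticCurves.Rank1Residual.Typed
  Literature.NumberTheory.EllipticCurves.Rank1Residual.X11RankOneCertificates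
  Summit.BirchSwinnertonDyer.BirchSwinnertonDyer.Rank1Residual
  Summit.BirchSwinnertonDyer.BirchSwinnertonDyer.Rank1Residual.IntModel
  Summit.BirchSwinnertonDyer.BirchSwinnertonDyer.Rank1Residual.X11RankOne
  Summit.BirchSwinnertonDyer.BirchSwinnertonDyer.Rank2Observatory.Tam
  Summit.BirchSwinnertonDyer.Rank1Residual Summit.BirchSwinnertonDyer.Rank1Residual.X11b

namespace Summit.BirchSwinnertonDyer.Rank1Residual.JET

/-- **Bucket A, `p = 3`, ANY reduction at `3` (additive included), carrier `q ≠ 3` split multiplicative: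
`BSD(E,3)` for a literal integer model from the two-engine HEEGNER-INDEX line `ord₃ [E(K):ℤP] ≤ w` through
the bucket-A reading binder, with `ρ̄_{E,3}` ONTO, the `3`-adic tower by ONE Frobenius witness modulo `9`,
and `w ≤ ord₃ c_q(E)` CHECKED IN THE KERNEL.** Kernel inputs: `hmin`; TWO Frobenius witnesses at odd good
`ℓ₁, ℓ₂ ≠ 3` (schema counts `countPoints [a] ℓᵢ = nᵢ`): (i) `X² − a₁X + ℓ₁` irreducible mod `3`; (ii)
`ℓ₂ ≡ 1`, `a₂ ≡ 2 (mod 3)`, `9 ∤ n₂`; ONE tower witness `ℓ₉` (odd good prime, count `n₉`) with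
`ℓ₉ ≡ 2, 5 (mod 9)` and `ℓ₉ + 1 − n₉ ≡ 3, 6 (mod 9)`; ONE `TamLocal` certificate at `q = T.p` with value set
`[c]`, `w ≤ ord₃ c`, `q ≠ 3`. Displayed binders: the READING `hJ`, the published `hMcU`, `hGZK`, `hKo`,
`hrec`, `hD36`, `hlev`; the Heegner datum (`K` with `d_K ∉ {−3,−4}`, Heegner hypothesis for `N`, `P` of
infinite order), `q ∣ N`, the INDEX LINE `hv`, `r_an ≤ 1`, `#Ш_an = s` with `ord₃ s = 0`. Output via pv-1's
`JET.bsdp_of_carrierNeCertificate_level` at the certified tower. CONDITIONAL on every binder; per pair; no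
class statement. [cite: Jetchev2008, Cor. 1.5 (p. 812)] [cite: SerreAbelianLadic1968, Ch. IV §3.4 Lemma 3 (IV-23)]
[cite: Elkies2006, Introduction (p. 1)] [cite: Serre1972, §2.4 Prop. 15 and §5.2 (iii)]
[cite: SilvermanATAEC1994, IV.9.4] [cite: Miller2011LMS, Def. 1.1] -/
theorem bsdp_of_jetRowA3F_tam_min (a1 a2 a3 a4 a6 : ℤ)
    (hmin : (⟨a1, a2, a3, a4, a6⟩ : WeierstrassCurve ℚ).IsGloballyMinimal)
    (ℓ₁ ℓ₂ : ℕ) (hℓ₁ : ℓ₁.Prime) (hℓ₂ : ℓ₂.Prime) (h2₁ : ℓ₁ ≠ 2) (h2₂ : ℓ₂ ≠ 2)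
    (h3₁ : ℓ₁ ≠ 3) (h3₂ : ℓ₂ ≠ 3)
    (hΔ₁ : ¬ (ℓ₁ : ℤ) ∣ discOf [a1, a2, a3, a4, a6]) (hΔ₂ : ¬ (ℓ₂ : ℤ) ∣ discOf [a1, a2, a3, a4, a6])
    {n₁ n₂ : ℕ} (hc₁ : countPoints [a1, a2, a3, a4, a6] ℓ₁ = n₁)
    (hc₂ : countPoints [a1, a2, a3, a4, a6] ℓ₂ = n₂)
    (hirr : ∀ t : ZMod 3, t ^ 2 - (((ℓ₁ : ℤ) + 1 - n₁ : ℤ) : ZMod 3) * t + ℓ₁ ≠ 0)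
    (hdet₂ : (ℓ₂ : ZMod 3) = 1) (htr₂ : (((ℓ₂ : ℤ) + 1 - n₂ : ℤ) : ZMod 3) = 2) (hsq : ¬ 9 ∣ n₂)
    (ℓ₉ : ℕ) (hℓ₉ : ℓ₉.Prime) (h2₉ : ℓ₉ ≠ 2)
    (hΔ₉ : ¬ (ℓ₉ : ℤ) ∣ (⟨a1, a2, a3, a4, a6⟩ : WeierstrassCurve ℤ).Δ)
    {n₉ : ℕ} (hc₉ : countPoints [a1, a2, a3, a4, a6] ℓ₉ = n₉)
    (hℓ9 : ℓ₉ % 9 = 2 ∨ ℓ₉ % 9 = 5)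
    (ha9 : ((ℓ₉ : ℤ) + 1 - n₉) % 9 = 3 ∨ ((ℓ₉ : ℤ) + 1 - n₉) % 9 = 6)
    (q : ℕ) (T : TamLocal) (hTq : T.p = q) (hT : T.check ⟨a1, a2, a3, a4, a6⟩ = true)
    {c : ℕ} (hvals : T.vals = [c]) {w : ℕ} (hw : w ≤ padicValNat 3 c) (hq3 : q ≠ 3)
    (hJ : JetchevDivisibilityCarrierNe)
    (hMcU : McCallum1991_padicValNat_card_sha_primary_add_le_of_globalDivisibility)
    (hGZK : rank_eq_analyticRank_of_analyticRank_le_one)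
    (hKo : ∀ (N : ℕ) [NeZero N] (W : WeierstrassCurve ℚ) (K : Type) [Field K] [NumberField K], kolyvagin N W K)
    (hrec : ∀ (N : ℕ) [NeZero N] (W : WeierstrassCurve ℚ) (K : Type) [Field K] [NumberField K],
      heegnerPointOfConductor_one_galoisConj N W K)
    (hD36 : ∀ (N : ℕ) [NeZero N] (W : WeierstrassCurve ℚ) (K : Type) [Field K] [NumberField K],
      phi_heegnerTau_mem_singularModuliField N W K)
    (hlev : ∀ {N : ℕ} [NeZero N], IsNewformOf.level_eq_conductorNorm (N := N))
    (W : WeierstrassCurve ℚ) (hW : W = ⟨a1, a2, a3, a4, a6⟩)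
    {N : ℕ} [NeZero N] {K : Type} [Field K] [NumberField K] (hK : IsImaginaryQuadratic K)
    (hD3 : NumberField.discr K ≠ -3) (hD4 : NumberField.discr K ≠ -4)
    (hH : SatisfiesHeegnerHypothesis N K) {P : (W.baseChange K).toAffine.Point}
    (hP : IsHeegnerPoint N W K P) (hnt : ¬ IsOfFinAddOrder P) (hqN : q ∣ N)
    (hv : padicValNat 3 (AddSubgroup.zmultiples P).index ≤ w)
    (hr : W.analyticRank ≤ 1) {s : ℚ} (hs : shaAn W = (s : ℂ)) (hvs : padicValRat 3 s = 0) :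
    BSDp W 3 := by
  subst hW
  have h0 : discOf [a1, a2, a3, a4, a6] ≠ 0 := fun h ↦ hΔ₁ (by rw [h]; exact dvd_zero _)
  haveI hE : (⟨a1, a2, a3, a4, a6⟩ : WeierstrassCurve ℚ).IsElliptic :=
    X11b.isElliptic_of_discOf_ne_zero a1 a2 a3 a4 a6 h0
  haveI := hmin
  haveI : Fact (Nat.Prime 3) := ⟨by norm_num⟩
  haveI : Fact (Nat.Prime q) := ⟨hTq ▸ (TamLocal.check_common hT).1⟩
  haveI := Fact.mk hℓ₉
  have hI0 : integralModelInt (⟨a1, a2, a3, a4, a6⟩ : WeierstrassCurve ℚ) = ⟨a1, a2, a3, a4, a6⟩ :=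
    integralModelInt_eq_of_map_eq _ (map_mk_int a1 a2 a3 a4 a6)
  -- `ρ̄_{E,3}` onto from the two Frobenius witnesses (irreducible + order 3)
  have hρ : Surj (⟨a1, a2, a3, a4, a6⟩ : WeierstrassCurve ℚ) 3 :=
    Supersingular.surj_three_of_ainvs_of_irr_of_order a1 a2 a3 a4 a6 hmin ℓ₁ ℓ₂ hℓ₁ hℓ₂ h2₁ h2₂ h3₁ h3₂
      hΔ₁ hΔ₂ hc₁ hc₂ hirr hdet₂ htr₂ hsq
  -- the `3`-adic tower from the mod-`9` Frobenius witness (Serre IV-23)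
  have hn₉ : Nat.card (((⟨a1, a2, a3, a4, a6⟩ : WeierstrassCurve ℤ).map
      (Int.castRingHom (ZMod ℓ₉))).toAffine.Point) = n₉ := by
    exact_mod_cast (X11b.natCard_point_eq_countPoints a1 a2 a3 a4 a6 ℓ₉ h2₉ hΔ₉).trans hc₉
  have htower : ∀ n : ℕ, (⟨a1, a2, a3, a4, a6⟩ : WeierstrassCurve ℚ).HasSurjectiveModNGaloisRep (3 ^ n : ℕ) :=
    GaloisImage.forall_hasSurjectiveModNGaloisRep_three_pow_of_intModel_of_frobenius hI0 hρ ℓ₉ hΔ₉ hn₉ hℓ9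
      ha9
  -- the Tamagawa half in the kernel: `c_q(W/ℚ_q) = c`
  have hcq : ((⟨a1, a2, a3, a4, a6⟩ : WeierstrassCurve ℚ).baseChange ℚ_[q]).localTamagawaNumber ℤ_[q] = c :=
    Additive.IntModelTam.localTamagawaNumber_padic_eq_of_intModel_of_tamLocal hI0 q hTq hT hvals
  have hI : padicValNat 3 (AddSubgroup.zmultiples P).index ≤ padicValNat 3
      (((⟨a1, a2, a3, a4, a6⟩ : WeierstrassCurve ℚ).baseChange ℚ_[q]).localTamagawaNumber ℤ_[q]) := hcq ▸ hv.trans hw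
  exact bsdp_of_carrierNeCertificate_level hJ hMcU hGZK hKo hrec hD36 hlev _ 3 hK hD3 hD4 hH hP hnt
    (by decide) htower q hqN hq3 hI hr hs hvs

/-- **Bucket A, `p = 3`, ANY reduction at `3`, carrier `q ≠ 3` ADDITIVE of type `IV` / `IV*` (`c_q = 3`):
as `bsdp_of_jetRowA3F_tam_min` with the Tamagawa half from an EXACT stage-2 certificate `F : TamX`**
(bridge `Additive.IntModelTam.localTamagawaNumber_padic_eq_of_intModel_of_tamX`), `w ≤ ord₃ F.c`.
CONDITIONAL on every binder; per pair; no class statement. [cite: Jetchev2008, Cor. 1.5 (p. 812)]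
[cite: SerreAbelianLadic1968, Ch. IV §3.4 Lemma 3 (IV-23)] [cite: Elkies2006, Introduction (p. 1)]
[cite: Serre1972, §2.4 Prop. 15 and §5.2 (iii)] [cite: SilvermanATAEC1994, IV.9.4 Steps 5 and 8] -/
theorem bsdp_of_jetRowA3F_tamX_min (a1 a2 a3 a4 a6 : ℤ)
    (hmin : (⟨a1, a2, a3, a4, a6⟩ : WeierstrassCurve ℚ).IsGloballyMinimal)
    (ℓ₁ ℓ₂ : ℕ) (hℓ₁ : ℓ₁.Prime) (hℓ₂ : ℓ₂.Prime) (h2₁ : ℓ₁ ≠ 2) (h2₂ : ℓ₂ ≠ 2)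
    (h3₁ : ℓ₁ ≠ 3) (h3₂ : ℓ₂ ≠ 3)
    (hΔ₁ : ¬ (ℓ₁ : ℤ) ∣ discOf [a1, a2, a3, a4, a6]) (hΔ₂ : ¬ (ℓ₂ : ℤ) ∣ discOf [a1, a2, a3, a4, a6])
    {n₁ n₂ : ℕ} (hc₁ : countPoints [a1, a2, a3, a4, a6] ℓ₁ = n₁)
    (hc₂ : countPoints [a1, a2, a3, a4, a6] ℓ₂ = n₂)
    (hirr : ∀ t : ZMod 3, t ^ 2 - (((ℓ₁ : ℤ) + 1 - n₁ : ℤ) : ZMod 3) * t + ℓ₁ ≠ 0)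
    (hdet₂ : (ℓ₂ : ZMod 3) = 1) (htr₂ : (((ℓ₂ : ℤ) + 1 - n₂ : ℤ) : ZMod 3) = 2) (hsq : ¬ 9 ∣ n₂)
    (ℓ₉ : ℕ) (hℓ₉ : ℓ₉.Prime) (h2₉ : ℓ₉ ≠ 2)
    (hΔ₉ : ¬ (ℓ₉ : ℤ) ∣ (⟨a1, a2, a3, a4, a6⟩ : WeierstrassCurve ℤ).Δ)
    {n₉ : ℕ} (hc₉ : countPoints [a1, a2, a3, a4, a6] ℓ₉ = n₉)
    (hℓ9 : ℓ₉ % 9 = 2 ∨ ℓ₉ % 9 = 5)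
    (ha9 : ((ℓ₉ : ℤ) + 1 - n₉) % 9 = 3 ∨ ((ℓ₉ : ℤ) + 1 - n₉) % 9 = 6)
    (q : ℕ) (hq : q.Prime) (F : TamX) (hFq : F.p = q) (hF : F.check ⟨a1, a2, a3, a4, a6⟩ = true)
    {w : ℕ} (hw : w ≤ padicValNat 3 F.c) (hq3 : q ≠ 3)
    (hJ : JetchevDivisibilityCarrierNe)
    (hMcU : McCallum1991_padicValNat_card_sha_primary_add_le_of_globalDivisibility)
    (hGZK : rank_eq_analyticRank_of_analyticRank_le_one)
    (hKo : ∀ (N : ℕ) [NeZero N] (W : WeierstrassCurve ℚ) (K : Type) [Field K] [NumberField K], kolyvagin N W K)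
    (hrec : ∀ (N : ℕ) [NeZero N] (W : WeierstrassCurve ℚ) (K : Type) [Field K] [NumberField K],
      heegnerPointOfConductor_one_galoisConj N W K)
    (hD36 : ∀ (N : ℕ) [NeZero N] (W : WeierstrassCurve ℚ) (K : Type) [Field K] [NumberField K],
      phi_heegnerTau_mem_singularModuliField N W K)
    (hlev : ∀ {N : ℕ} [NeZero N], IsNewformOf.level_eq_conductorNorm (N := N))
    (W : WeierstrassCurve ℚ) (hW : W = ⟨a1, a2, a3, a4, a6⟩)
    {N : ℕ} [NeZero N] {K : Type} [Field K] [NumberField K] (hK : IsImaginaryQuadratic K)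
    (hD3 : NumberField.discr K ≠ -3) (hD4 : NumberField.discr K ≠ -4)
    (hH : SatisfiesHeegnerHypothesis N K) {P : (W.baseChange K).toAffine.Point}
    (hP : IsHeegnerPoint N W K P) (hnt : ¬ IsOfFinAddOrder P) (hqN : q ∣ N)
    (hv : padicValNat 3 (AddSubgroup.zmultiples P).index ≤ w)
    (hr : W.analyticRank ≤ 1) {s : ℚ} (hs : shaAn W = (s : ℂ)) (hvs : padicValRat 3 s = 0) :
    BSDp W 3 := by
  subst hW
  have h0 : discOf [a1, a2, a3, a4, a6] ≠ 0 := fun h ↦ hΔ₁ (by rw [h]; exact dvd_zero _)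
  haveI hE : (⟨a1, a2, a3, a4, a6⟩ : WeierstrassCurve ℚ).IsElliptic :=
    X11b.isElliptic_of_discOf_ne_zero a1 a2 a3 a4 a6 h0
  haveI := hmin
  haveI : Fact (Nat.Prime 3) := ⟨by norm_num⟩
  haveI : Fact (Nat.Prime q) := ⟨hq⟩
  haveI := Fact.mk hℓ₉
  have hI0 : integralModelInt (⟨a1, a2, a3, a4, a6⟩ : WeierstrassCurve ℚ) = ⟨a1, a2, a3, a4, a6⟩ :=
    integralModelInt_eq_of_map_eq _ (map_mk_int a1 a2 a3 a4 a6)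
  have hρ : Surj (⟨a1, a2, a3, a4, a6⟩ : WeierstrassCurve ℚ) 3 :=
    Supersingular.surj_three_of_ainvs_of_irr_of_order a1 a2 a3 a4 a6 hmin ℓ₁ ℓ₂ hℓ₁ hℓ₂ h2₁ h2₂ h3₁ h3₂
      hΔ₁ hΔ₂ hc₁ hc₂ hirr hdet₂ htr₂ hsq
  have hn₉ : Nat.card (((⟨a1, a2, a3, a4, a6⟩ : WeierstrassCurve ℤ).map
      (Int.castRingHom (ZMod ℓ₉))).toAffine.Point) = n₉ := by
    exact_mod_cast (X11b.natCard_point_eq_countPoints a1 a2 a3 a4 a6 ℓ₉ h2₉ hΔ₉).trans hc₉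
  have htower : ∀ n : ℕ, (⟨a1, a2, a3, a4, a6⟩ : WeierstrassCurve ℚ).HasSurjectiveModNGaloisRep (3 ^ n : ℕ) :=
    GaloisImage.forall_hasSurjectiveModNGaloisRep_three_pow_of_intModel_of_frobenius hI0 hρ ℓ₉ hΔ₉ hn₉ hℓ9
      ha9
  -- the Tamagawa half in the kernel: `c_q(W/ℚ_q) = F.c` (exact IV / IV* certificate)
  have hcq : ((⟨a1, a2, a3, a4, a6⟩ : WeierstrassCurve ℚ).baseChange ℚ_[q]).localTamagawaNumber ℤ_[q] = F.c :=
    Additive.IntModelTam.localTamagawaNumber_padic_eq_of_intModel_of_tamX hI0 q hFq hF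
  have hI : padicValNat 3 (AddSubgroup.zmultiples P).index ≤ padicValNat 3
      (((⟨a1, a2, a3, a4, a6⟩ : WeierstrassCurve ℚ).baseChange ℚ_[q]).localTamagawaNumber ℤ_[q]) := hcq ▸ hv.trans hw
  exact bsdp_of_carrierNeCertificate_level hJ hMcU hGZK hKo hrec hD36 hlev _ 3 hK hD3 hD4 hH hP hnt
    (by decide) htower q hqN hq3 hI hr hs hvs

end Summit.BirchSwinnertonDyer.Rank1Residual.JET

end
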